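import Literature.AlgebraicGeometry.Resolution.InseparableLocalUniformizationDefectStep
import Literature.AlgebraicGeometry.Resolution.InseparableLocalUniformizationEngineTower
import Literature.AlgebraicGeometry.Resolution.InseparableLocalUniformizationCurvesStepOne
import Literature.AlgebraicGeometry.Resolution.InseparableLocalUniformizationAbhyankar
import HarnessLib

/-!
# Inseparable local uniformization: the induction step on the transcendence defect, re-threaded through the corrected Steps 3–4

Topic: `Literature/AlgebraicGeometry/Resolution`. M. Temkin, *Inseparable local uniformization*,
J. Algebra 373 (2013) 65–119 = arXiv:0804.1554v3, proof of Thm. 4.1.1 (pp. 47–50; pp. 29–30 of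
the 41-pp. arXiv version held in the literature store).

`InseparableLocalUniformizationDefectStep.lean` PROVES Steps 0–2 of the proof of Thm. 4.1.1 and
assembles `Temkin2013DescentDefectStep.of_relativeCurve_of_steps34 :
Temkin2013RelativeCurve → Temkin2013_Steps34 → Temkin2013DescentDefectStep`. The named fact
`Temkin2013_Steps34` taken there is MIS-RENDERED (its binders `[Algebra k̄ K₁]
[IsScalarTower k̄ K K₁]` leave the `k̄`-structure of `K₁` free; see
`InseparableLocalUniformizationEngineTower.lean`, which vendors the corrected, weaker
`Temkin2013_Steps34_tower` and proves `Temkin2013_Steps34 → Temkin2013_Steps34_tower`). That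
proof only ever USES the corrected specialisation (it feeds `h34` the field `L₁ ⊇ L = K(l)` with
its inherited `l′`-structure), so it goes through VERBATIM with the weaker hypothesis; this file
records that:

* `Temkin2013DescentDefectStep.of_relativeCurve_of_steps34_tower :
    Temkin2013RelativeCurve → Temkin2013_Steps34_tower → Temkin2013DescentDefectStep` — PROVED
  (proof text = that of `.of_relativeCurve_of_steps34`, hypothesis weakened);
* corollaries moving the frontier lists of `InseparableLocalUniformizationDefectStep.lean`,
  `…CurvesStepOne.lean` / `…Frontier.lean` to the corrected fact:
  `Temkin2013Descent.of_relativeCurve_of_steps34_tower`,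
  `Temkin2013HeightLeOne.of_curve_frontier_tower`,
  `Temkin2013DescentDefectStep.of_curve_frontier_tower`
  (`Temkin2013CurveSmoothing → Temkin2013RelativeCurveSmoothFibre → Temkin2013_Steps34_tower →
  Temkin2013DescentDefectStep`), `Temkin2013Descent.of_frontier₃_tower` and
  `Temkin2013HeightLeOne.of_frontier₃_tower`.

The frontier of `Temkin2013DescentDefectStep` is thus `{Temkin2013CurveSmoothing,
Temkin2013RelativeCurveSmoothFibre, Temkin2013_Steps34_tower}`; `Temkin2013_Steps34_tower` is
being proved from Lemmas 2.8.4/2.8.5, `Temkin2013_valuationRingOpen` (all discharged) and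
`Stacks05B5` in the companion files (`InseparableLocalUniformizationStepThree.lean` ff.).

## Sources

* M. Temkin, *Inseparable local uniformization*, arXiv:0804.1554v3: proof of Thm. 4.1.1, Steps
  0–4 (pp. 47–50); Thm. 3.3.1 (p. 44); Remark 2.1.2 (p. 10).
-/

noncomputable section

open IsLocalRing Cardinal

namespace Literature.AlgebraicGeometry.Resolution

universe u

section defectStep

-- one long proof through five fields `k ⊆ k̄ ⊆ K ⊆ L ⊆ L₁` (and `l' ⊆ L`, `m ⊇ l`): the whole
-- elaboration needs twice the default budget (no single step is expensive)
set_option maxHeartbeats 400000 in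
/-- **Steps 0–2 of the proof of Thm. 4.1.1, and the induction step assembled** (Temkin 2013,
proof of Thm. 4.1.1, pp. 47–48: Step 0 "we assume that `D = D_{K/k} > 0` and the theorem is
proved for smaller `D`'s. … we can replace the field `K` with a finite purely inseparable
extension and update `X` and `Kᵢ`'s accordingly"; Step 1 "Fiber `X` by curves and apply Theorem
3.3.1. Since `D_{K/k} > 0`, it follows from Remark 2.1.2 that there exists a valued subfield
`k̄ ↪ K` containing `k` and such that `tr.deg._{k̄}(K) = 1` and `K/k̄` is transcendentally
immediate; in particular, `D_{k̄/k} = D - 1`. … consider `C = Nr_K(X ×_Y S)` … Theorem 3.3.1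
applies to `C`, `Kᵢ/K` and `S`"; Step 2 "Refine `X` and `Y` and extend `K` so that … `f_C` is
an identity and `l = k̄`. Since `C′ = Spec(A)` where `A` is the normalization of a subring
`k̄°[f₁, …, f_n] ⊂ K°`, we can use `fᵢ`'s to define an affine refinement `X′ → X` such that
`C′ = Nr_K(X′ ×_Y S)`. … Next, we extend the field `K` by replacing it with `L := lK`. Then `X`
is replaced with `X_L := Nr_L(X)`, and we can just replace `Y` and `C` with `Y_l := Nr_l(Y)` and
`Nr_L(X_l ×_{Y_l} S_l) →~ Nr_L(C)`"; Steps 3–4 are the named fact `Temkin2013_Steps34`, whose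
hypothesis "Thm. 4.1.1 applies to `Y`" is the induction hypothesis at `(l, l°)`,
`D_{l/k} = D_{k̄/k} = D - 1`). PROVED from the named facts `Temkin2013RelativeCurve`
(Thm. 3.3.1, `n = 1`) and `Temkin2013_Steps34_tower` (the CORRECTED rendering of Steps 3–4;
the proof is verbatim that of `Temkin2013DescentDefectStep.of_relativeCurve_of_steps34`, which
takes the mis-rendered, stronger `Temkin2013_Steps34` but only uses this specialisation); see
the module docstring of `InseparableLocalUniformizationDefectStep.lean` for the dictionary.
[cite: Temkin2013, proof of Thm. 4.1.1, Steps 0–4 (arXiv:0804.1554v3 pp. 47–50)] -/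
theorem Temkin2013DescentDefectStep.of_relativeCurve_of_steps34_tower
    (h331 : Temkin2013RelativeCurve.{u}) (h34 : Temkin2013_Steps34_tower.{u}) :
    Temkin2013DescentDefectStep.{u} := by
  intro d ih k K _ _ _ hfg O hk hdim hD A hAO hAfg hAfr hAn K₁ _ _ hfin₁ O₁ hO₁
  classical
  -- Step 0: the easy cases `D ≤ d` (induction hypothesis) and height `0`
  by_cases hDle : transcendenceDefect k O hk ≤ d
  · exact ih k K hfg O hk hdim hDle A hAO hAfg hAfr hAn K₁ hfin₁ O₁ hO₁
  by_cases htop : O = ⊤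
  · subst htop
    exact temkin2013DescentFor_top k K hfg A hAO hAfg hAfr hAn K₁ hfin₁ O₁ hO₁
  change Temkin2013DescentConclusion k K O A K₁ O₁
  haveI := hfin₁
  have hDpos : 0 < transcendenceDefect k O hk := by omega
  have hdim1 : ringKrullDim O = 1 := le_antisymm hdim (one_le_ringKrullDim_of_ne_top O htop)
  have hNK : Algebra.trdeg k K < ℵ₀ := trdeg_lt_aleph0_of_fg hfg
  ------------------------------------------------------------------
  -- Step 1: the fibration `k̄ ⊆ K` and its valuation ring `k̄°`
  ------------------------------------------------------------------
  obtain ⟨kb, hkbfg, htr1, himm, hDkb, -, -, hNkb⟩ :=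
    exists_intermediateField_trdeg_eq_one_isTranscendentallyImmediateOver k O hk hfg hDpos
  set Ob : ValuationSubring kb := O.comap (algebraMap kb K) with hObdef
  have hkOb : ∀ c : k, algebraMap k kb c ∈ Ob := algebraMap_mem_comap hk kb
  have hmemOb : ∀ y : kb, y ∈ Ob ↔ (y : K) ∈ O := fun y => Iff.rfl
  have hDkb' : transcendenceDefect k Ob hkOb + 1 = transcendenceDefect k O hk := hDkb
  have hDOb : transcendenceDefect k Ob hkOb = d := by omega
  have hkbfg' : (⊤ : IntermediateField k kb).FG :=
    IntermediateField.fg_top_iff.mpr (IntermediateField.essFiniteType_iff.mpr hkbfg)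
  have hfgkbK : (⊤ : IntermediateField kb K).FG := by
    haveI : Algebra.EssFiniteType k K := IntermediateField.fg_top_iff.mp hfg
    haveI : Algebra.EssFiniteType kb K := Algebra.EssFiniteType.of_comp k kb K
    exact IntermediateField.fg_top_iff.mpr ‹_›
  have hNkb' : Algebra.trdeg k kb < ℵ₀ :=
    calc Algebra.trdeg k kb ≤ Algebra.trdeg k kb + 1 := self_le_add_right _ _
      _ = Algebra.trdeg k K := hNkb
      _ < ℵ₀ := hNK
  have hvt : IsValueTorsionOver O (algebraMap kb K).fieldRange ⊤ := by
    rw [fieldRange_algebraMap_eq_toSubfield]; exact himm.1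
  have hra : IsResiduallyAlgebraicOver O (algebraMap kb K).fieldRange ⊤ := by
    rw [fieldRange_algebraMap_eq_toSubfield]; exact himm.2
  have hdimOb : ringKrullDim Ob = 1 :=
    ringKrullDim_comap_eq_one_of_isValueTorsionOver O hdim htop (algebraMap kb K) hvt
  have hchar : ringChar (ResidueField Ob) = ringChar kb :=
    ringChar_residueField_eq_of_algebraMap_mem Ob hkOb
  -- the curve `C = Nr_K(X ×_Y S)` over `S = Spec k̄°`
  obtain ⟨t, ht⟩ := id hAfg
  have htA : (t : Set K) ⊆ A := by rw [← ht]; exact Algebra.subset_adjoin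
  set XS : Subring K := etaModel kb (nrIn A.toSubring) Ob.toSubring with hXSdef
  have hXSmodel₀ : IsAffineNormalizedModel ⊤ (Ob.toSubring.map (algebraMap kb K)) XS :=
    isAffineNormalizedModel_etaModel A t ht hAfr Ob.toSubring hkOb
  have hXSO : XS ≤ O.toSubring :=
    etaModel_le_valuationSubring A O hAO Ob.toSubring (fun c hc => hc)
  have hXSmodel : IsAffineNormalizedModel O (Ob.toSubring.map (algebraMap kb K)) XS :=
    hXSmodel₀.of_le hXSO
  have hAXS : A.toSubring ≤ XS := (le_nrIn A.toSubring).trans (le_etaModel _ _)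
  have hObO : Ob.toSubring.map (algebraMap kb K) ≤ O.toSubring := by
    rintro _ ⟨y, hy, rfl⟩; exact hy
  ------------------------------------------------------------------
  -- Theorem 3.3.1 for `C`, `K₁/K` and `S`
  ------------------------------------------------------------------
  obtain ⟨A', hXSA', hA'model, L₁, instFL₁, instK₁L₁, instKL₁, instkbL₁, towKK₁L₁, towkbKL₁,
    hfinL₁, hpiL₁, l, hlfin, hlpi, hK₁l, O₁', hO₁', m, instFm, instlm, instkbm, towkblm, hmfin, -,
    Om, hOm, N, hN, hNint, hkN, hkm, hSE⟩ :=
    h331 kb K Ob O hchar rfl hdimOb hdim1 hfgkbK htr1 hvt hra XS hXSmodel K₁ hfin₁ O₁ hO₁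
  -- normalise the `k̄`-structure of `L₁` given by Thm. 3.3.1 to the restriction of its
  -- `K`-structure (they agree: `IsScalarTower k̄ K L₁`), so that no instance diamond arises
  have hinst : instkbL₁ = IntermediateField.instAlgebraSubtypeMem kb :=
    Algebra.algebra_ext _ _ fun c => IsScalarTower.algebraMap_apply kb K L₁ c
  subst hinst
  haveI := hfinL₁
  haveI := hpiL₁
  haveI := hlfin
  haveI := hlpi
  haveI := hmfin
  obtain ⟨hA'O, hObA''⟩ := hA'model.le_and_le hObO
  have hObA' : ∀ y : kb, y ∈ Ob → (y : K) ∈ A' := fun y hy => hObA'' ⟨y, hy, rfl⟩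
  obtain ⟨s, hsO, hA'set, -⟩ := hA'model
  obtain ⟨C₀, hC₀⟩ : ∃ C₀ : Subring K,
      C₀ = Subring.closure (↑(Ob.toSubring.map (algebraMap kb K)) ∪ (s : Set K)) := ⟨_, rfl⟩
  have hA'C₀ : A' = nrIn C₀ := by
    apply SetLike.coe_injective
    rw [hA'set, hC₀]
    rfl
  have hsA' : (s : Set K) ⊆ A' := fun y hy => by
    rw [hA'C₀]
    exact le_nrIn C₀ (by rw [hC₀]; exact Subring.subset_closure (Or.inr hy))
  -- `k`-structure on `L₁` through `K`, and the towers
  letI instkL₁ : Algebra k L₁ := ((algebraMap K L₁).comp (algebraMap k K)).toAlgebra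
  haveI : IsScalarTower k K L₁ := IsScalarTower.of_algebraMap_eq fun _ => rfl
  haveI : IsScalarTower k kb L₁ := IsScalarTower.of_algebraMap_eq fun c => by
    show (algebraMap K L₁) (algebraMap k K c) = algebraMap kb L₁ (algebraMap k kb c)
    rw [IsScalarTower.algebraMap_apply kb K L₁, ← IsScalarTower.algebraMap_apply k kb K]
  haveI : FiniteDimensional K L₁ := Module.Finite.trans K₁ L₁
  haveI : Algebra.IsAlgebraic K L₁ := Algebra.IsAlgebraic.of_finite K L₁
  have hO₁'K : O₁'.comap (algebraMap K L₁) = O := by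
    rw [IsScalarTower.algebraMap_eq K K₁ L₁, ← ValuationSubring.comap_comap, hO₁', hO₁]
  -- exponential characteristic
  obtain ⟨q, hq⟩ := ExpChar.exists k
  haveI := hq
  haveI hqkb : ExpChar kb q := expChar_of_injective_algebraMap (algebraMap k kb).injective q
  haveI hqK : ExpChar K q := expChar_of_injective_algebraMap (algebraMap k K).injective q
  ------------------------------------------------------------------
  -- Step 2: `L = K(l) ⊆ L₁`, its valuation ring, and the copy `l'` of `l` inside `L`
  ------------------------------------------------------------------
  set Lad : IntermediateField K L₁ := IntermediateField.adjoin K (l : Set L₁) with hLaddef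
  have hlLad : (l : Set L₁) ⊆ (Lad : Set L₁) := IntermediateField.subset_adjoin K _
  haveI hLadpi : IsPurelyInseparable K Lad := by
    rw [hLaddef, IntermediateField.isPurelyInseparable_adjoin_iff_pow_mem K L₁ q]
    intro x hx
    obtain ⟨n, y, hy⟩ := IsPurelyInseparable.pow_mem kb q (⟨x, hx⟩ : l)
    have hy' : algebraMap kb L₁ y = x ^ q ^ n := by
      have := congrArg (algebraMap l L₁) hy
      rw [← IsScalarTower.algebraMap_apply kb l L₁, map_pow] at this
      exact this
    exact ⟨n, algebraMap kb K y, by rw [← IsScalarTower.algebraMap_apply kb K L₁]; exact hy'⟩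
  haveI : IsScalarTower k Lad L₁ := IsScalarTower.of_algebraMap_eq fun _ => rfl
  haveI : FiniteDimensional Lad L₁ := Module.Finite.of_restrictScalars_finite K Lad L₁
  set OL : ValuationSubring Lad := O₁'.comap (algebraMap Lad L₁) with hOLdef
  have hmemOL : ∀ x : Lad, x ∈ OL ↔ (x : L₁) ∈ O₁' := fun x => Iff.rfl
  have hOLK : OL.comap (algebraMap K Lad) = O := by
    rw [hOLdef, ValuationSubring.comap_comap, ← IsScalarTower.algebraMap_eq K Lad L₁, hO₁'K]
  have hkOL : ∀ c : k, algebraMap k Lad c ∈ OL := fun c => by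
    have h1 : algebraMap k K c ∈ OL.comap (algebraMap K Lad) := by rw [hOLK]; exact hk c
    have h2 : algebraMap K Lad (algebraMap k K c) ∈ OL := h1
    rwa [← IsScalarTower.algebraMap_apply k K Lad] at h2
  have hfgL : (⊤ : IntermediateField k Lad).FG :=
    intermediateField_fg_top_of_finiteDimensional (F := K) hfg
  -- the copy `l'` of `l` inside `L`
  let ι : Lad →ₐ[k] L₁ := IsScalarTower.toAlgHom k Lad L₁
  let l' : IntermediateField k Lad := (l.restrictScalars k).comap ι
  have hmeml' : ∀ x : Lad, x ∈ l' ↔ (x : L₁) ∈ l := fun x => Iff.rfl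
  have hkbl' : ∀ c : kb, ((algebraMap K Lad).comp (algebraMap kb K)) c ∈ l' := fun c => by
    rw [hmeml']
    have : algebraMap kb L₁ c ∈ l := l.algebraMap_mem c
    rw [IsScalarTower.algebraMap_apply kb K L₁] at this
    exact this
  let algKbl' : kb →+* l' := ((algebraMap K Lad).comp (algebraMap kb K)).codRestrict l' hkbl'
  letI instkbl' : Algebra kb l' := algKbl'.toAlgebra
  -- shortcut instances (instance synthesis through the subtype towers is slow)
  letI : Module kb l' := Algebra.toModule
  letI : SMul kb l' := Algebra.toSMul
  have halgkbl' : ∀ y : kb, (((algebraMap kb l' y : l') : Lad) : L₁) = algebraMap kb L₁ y :=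
    fun _ => rfl
  haveI : IsScalarTower k kb l' := IsScalarTower.of_algebraMap_eq fun c => by
    apply Subtype.ext
    apply Subtype.ext
    show algebraMap k L₁ c = algebraMap K L₁ ((algebraMap k kb c : kb) : K)
    rfl
  -- the identification `e : l' ≅ l`
  let e : l' →+* l :=
    { toFun := fun x => ⟨((x : Lad) : L₁), (hmeml' x).mp x.2⟩
      map_one' := rfl
      map_mul' := fun _ _ => rfl
      map_zero' := rfl
      map_add' := fun _ _ => rfl }
  have he : ∀ x : l', (e x : L₁) = ((x : Lad) : L₁) := fun _ => rfl
  have he_surj : Function.Surjective e := fun z =>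
    ⟨⟨⟨(z : L₁), hlLad z.2⟩, (hmeml' _).mpr z.2⟩, Subtype.ext rfl⟩
  have he_inj : Function.Injective e := fun x y hxy =>
    Subtype.ext (Subtype.ext (congrArg (fun z : l => (z : L₁)) hxy))
  have he_alg : ∀ y : kb, e (algebraMap kb l' y) = algebraMap kb l y := fun y =>
    Subtype.ext (by rw [he, halgkbl']; rfl)
  haveI hfdl' : FiniteDimensional kb l' := by
    let f : l' →ₗ[kb] l :=
      { toFun := e
        map_add' := fun x y => map_add e x y
        map_smul' := fun c x => by
          rw [RingHom.id_apply, Algebra.smul_def, Algebra.smul_def, map_mul, he_alg] }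
    exact FiniteDimensional.of_injective f he_inj
  haveI : Algebra.IsAlgebraic kb l' := Algebra.IsAlgebraic.of_finite kb l'
  haveI hl'pi : IsPurelyInseparable kb l' := by
    rw [isPurelyInseparable_iff_pow_mem kb q]
    intro x
    obtain ⟨n, y, hy⟩ := IsPurelyInseparable.pow_mem kb q (e x)
    refine ⟨n, y, he_inj ?_⟩
    rw [he_alg, map_pow]
    exact hy
  have hl'fg : (⊤ : IntermediateField k l').FG :=
    intermediateField_fg_top_of_finiteDimensional (F := kb) hkbfg'
  -- the valuation ring `l'° = L° ∩ l'`
  set Ol' : ValuationSubring l' := OL.comap (algebraMap l' Lad) with hOl'def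
  have hmemOl' : ∀ x : l', x ∈ Ol' ↔ ((x : Lad) : L₁) ∈ O₁' := fun x => Iff.rfl
  have hOl'kb : Ol'.comap (algebraMap kb l') = Ob := by
    ext y
    show algebraMap K L₁ (algebraMap kb K y) ∈ O₁' ↔ (y : K) ∈ O
    rw [← hO₁'K]
    rfl
  have hkOl' : ∀ c : k, algebraMap k l' c ∈ Ol' := fun c => hkOL c
  have hdiml' : ringKrullDim Ol' = 1 := by
    rw [ringKrullDim_eq_comap_of_isPurelyInseparable (K := kb) Ol', hOl'kb, hdimOb]
  have hDl' : transcendenceDefect k Ol' hkOl' ≤ d := by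
    have h := transcendenceDefect_le_of_isAlgebraic (F := kb) Ol' Ob hOl'kb hkOl' hkOb hNkb'
    rwa [hDOb] at h
  -- "the induction assumption applies to the scheme `Y`" (for `l'`, `l'°`)
  have hDY : Temkin2013DescentFor k l' Ol' := ih k l' hl'fg Ol' hkOl' hdiml'.le hDl'
  -- `qⁿ`-th powers of elements of `l'` lie in `k̄`
  have hpow : ∀ x : l', ∃ n : ℕ, ∃ y : kb, algebraMap kb l' y = x ^ q ^ n := fun x => by
    obtain ⟨n, y, hy⟩ := IsPurelyInseparable.pow_mem kb q x
    exact ⟨n, y, hy⟩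
  choose nn yy hyy using hpow
  have hyyOb : ∀ x : l', x ∈ Ol' → yy x ∈ Ob := fun x hx => by
    have h1 : algebraMap kb l' (yy x) ∈ Ol' := by rw [hyy]; exact pow_mem hx _
    have h2 : yy x ∈ Ol'.comap (algebraMap kb l') := h1
    rwa [hOl'kb] at h2
  have hyyL₁ : ∀ x : l', ((x : Lad) : L₁) ^ q ^ nn x = algebraMap kb L₁ (yy x) := fun x => by
    have h := congrArg ((algebraMap Lad L₁).comp (algebraMap l' Lad)) (hyy x)
    rw [map_pow] at h
    exact h.symm
  ------------------------------------------------------------------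
  -- Step 2a: an affine model `B'` of `l'°` and the refinement `X″ = Nr_K(A[f, c])` of `X`
  ------------------------------------------------------------------
  obtain ⟨B', hB'O, hB'fg, hB'fr⟩ := exists_affineModel k l' hl'fg Ol' hkOl'
  obtain ⟨b', hb'⟩ := id hB'fg
  have hb'B' : (b' : Set l') ⊆ B' := by rw [← hb']; exact Algebra.subset_adjoin
  set cset : Finset K := b'.image fun x : l' => ((yy x : kb) : K) with hcset
  have hcmem : ∀ y : K, y ∈ cset → ∃ x : l', x ∈ b' ∧ ((yy x : kb) : K) = y := fun y hy => by
    simpa [hcset, Finset.mem_image] using hy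
  have hcO : (cset : Set K) ⊆ (O : Set K) := fun y hy => by
    obtain ⟨x, hx, rfl⟩ := hcmem y hy
    exact (hmemOb _).mp (hyyOb x (hB'O (hb'B' hx)))
  have hcA' : (cset : Set K) ⊆ A' := fun y hy => by
    obtain ⟨x, hx, rfl⟩ := hcmem y hy
    exact hObA' _ (hyyOb x (hB'O (hb'B' hx)))
  set A₁ : Subalgebra k K := Algebra.adjoin k (↑t ∪ ↑s ∪ ↑cset) with hA₁def
  have hAA₁ : A ≤ A₁ := by
    rw [← ht]
    exact Algebra.adjoin_mono fun y hy => Or.inl (Or.inl hy)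
  have hA₁fg : A₁.FG := ⟨t ∪ s ∪ cset, by rw [Finset.coe_union, Finset.coe_union]⟩
  let Oalg : Subalgebra k K := { O.toSubring.toSubsemiring with algebraMap_mem' := hk }
  have hA₁O : A₁.toSubring ≤ O.toSubring := by
    have : A₁ ≤ Oalg := Algebra.adjoin_le (Set.union_subset (Set.union_subset (htA.trans hAO)
      hsO) hcO)
    exact fun y hy => this hy
  have hA₁fr : IsFractionRing A₁ K := by
    haveI := hAfr
    refine IsFractionRing.of_field A₁ K fun z => ?_
    obtain ⟨a, b, -, rfl⟩ := IsFractionRing.div_surjective (A := A) z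
    exact ⟨⟨a, hAA₁ a.2⟩, ⟨b, hAA₁ b.2⟩, rfl⟩
  obtain ⟨A₂, hA₁A₂, hA₂O, hA₂fg, hA₂fr, hA₂n, hA₂set⟩ :=
    exists_normal_affineModel_ge' O A₁ hA₁O hA₁fg hA₁fr
  have hAA₂ : A ≤ A₂ := hAA₁.trans hA₁A₂
  have hA₁A' : A₁.toSubring ≤ A' := by
    intro y hy
    have hy' : y ∈ (Algebra.adjoin k (↑t ∪ ↑s ∪ ↑cset : Set K)).toSubring := hy
    rw [Algebra.adjoin_eq_ring_closure] at hy'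
    refine (Subring.closure_le.mpr ?_) hy'
    rintro z (⟨c, rfl⟩ | ((hz | hz) | hz))
    · exact hObA' _ (hkOb c)
    · exact hXSA' (hAXS (htA hz))
    · exact hsA' hz
    · exact hcA' hz
  have hA₂A' : A₂.toSubring ≤ A' := fun x hx => by
    have hx' : IsIntegral A₁ x := by
      have hx2 : x ∈ (A₂ : Set K) := hx
      rw [hA₂set] at hx2
      exact hx2
    have h1 : x ∈ nrIn A₁.toSubring := hx'
    have h2 : x ∈ nrIn A' := nrIn_mono hA₁A' h1
    rw [hA'C₀, nrIn_nrIn] at h2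
    rw [hA'C₀]
    exact h2
  ------------------------------------------------------------------
  -- Step 2b: `A_L = Nr_L(X″)`, a normal affine model of `L°` containing `B'`
  ------------------------------------------------------------------
  obtain ⟨AL, hALset, hALfg, hALfr, hALn⟩ := exists_normalisation_in_extension A₂ hA₂fg hA₂fr Lad
  have hmemAL : ∀ x : Lad, x ∈ AL ↔ IsIntegral (A₂.map (IsScalarTower.toAlgHom k K Lad)) x :=
    fun x => by rw [← SetLike.mem_coe, hALset]; rfl
  have hA₂AL : ∀ a ∈ A₂, algebraMap K Lad a ∈ AL := fun a ha => by
    rw [hmemAL]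
    exact isIntegral_algebraMap
      (x := (⟨_, Subalgebra.mem_map.mpr ⟨a, ha, rfl⟩⟩ : A₂.map (IsScalarTower.toAlgHom k K Lad)))
  have hA₂OL : ∀ a ∈ A₂, algebraMap K Lad a ∈ OL := fun a ha => by
    have : a ∈ OL.comap (algebraMap K Lad) := by rw [hOLK]; exact hA₂O ha
    exact this
  have hALO : AL.toSubring ≤ OL.toSubring := fun x hx => by
    have hx' := (hmemAL x).mp hx
    refine mem_valuationSubring_of_isIntegral OL (A₂.map (IsScalarTower.toAlgHom k K Lad)) ?_ hx'
    rintro _ ⟨a, ha, rfl⟩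
    exact hA₂OL a ha
  have hB'AL : ∀ b : B', algebraMap l' Lad b ∈ AL := by
    have hle : B'.map (IsScalarTower.toAlgHom k l' Lad) ≤ AL := by
      rw [← hb', AlgHom.map_adjoin]
      refine Algebra.adjoin_le ?_
      rintro _ ⟨x, hx, rfl⟩
      rw [SetLike.mem_coe, hmemAL]
      show IsIntegral _ (x : Lad)
      refine IsIntegral.of_pow (expChar_pow_pos kb q (nn x)) ?_
      have hx1 : (x : Lad) ^ q ^ nn x = algebraMap K Lad ((yy x : kb) : K) := by
        apply Subtype.ext
        rw [SubmonoidClass.coe_pow, hyyL₁ x, IsScalarTower.algebraMap_apply kb K L₁]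
        rfl
      rw [hx1]
      have hmem : ((yy x : kb) : K) ∈ A₂ :=
        hA₁A₂ (Algebra.subset_adjoin (Or.inr (Finset.mem_coe.mpr
          (Finset.mem_image.mpr ⟨x, hx, rfl⟩))))
      exact hA₂AL _ hmem |> fun h => (hmemAL _).mp h
    intro b
    exact hle (Subalgebra.mem_map.mpr ⟨b, b.2, rfl⟩)
  ------------------------------------------------------------------
  -- the identification `Nr_{L₁}(A_L · l'°) = N = Nr_{L₁}(C')`
  ------------------------------------------------------------------
  have hNeq : N = nrIn (A'.map (algebraMap K L₁)) := SetLike.coe_injective (by rw [hNint]; rfl)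
  have hNn : nrIn N = N := by rw [hNeq, nrIn_nrIn]
  have hA'N : A'.map (algebraMap K L₁) ≤ N := by rw [hNeq]; exact le_nrIn _
  have hObN : ∀ y : kb, y ∈ Ob → algebraMap kb L₁ y ∈ N := fun y hy => by
    rw [IsScalarTower.algebraMap_apply kb K L₁]
    exact hA'N ⟨(y : K), hObA' y hy, rfl⟩
  have hOl'N : ∀ x : l', x ∈ Ol' → ((x : Lad) : L₁) ∈ N := fun x hx => by
    rw [← hNn, mem_nrIn_iff]
    refine IsIntegral.of_pow (expChar_pow_pos kb q (nn x)) ?_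
    rw [hyyL₁ x]
    exact isIntegral_algebraMap (R := N) (x := ⟨_, hObN (yy x) (hyyOb x hx)⟩)
  have hA₂N : ∀ a ∈ A₂, algebraMap K L₁ a ∈ N := fun a ha => hA'N ⟨a, hA₂A' ha, rfl⟩
  have hALN : ∀ x : Lad, x ∈ AL → (x : L₁) ∈ N := fun x hx => by
    have hx' := (hmemAL x).mp hx
    rw [← hNn, mem_nrIn_iff]
    have hmaple : (A₂.map (IsScalarTower.toAlgHom k K Lad)).toSubring.map (algebraMap Lad L₁) ≤
        N := by
      rintro _ ⟨z, hz, rfl⟩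
      obtain ⟨a, ha, rfl⟩ := Subalgebra.mem_map.mp (show z ∈ A₂.map _ from hz)
      exact hA₂N a ha
    exact isIntegral_map_of_map_le (algebraMap Lad L₁) hmaple hx'
  set T₁ : Subring L₁ := nrIn (AL.toSubring.map (algebraMap Lad L₁)) ⊔
    Ol'.toSubring.map (algebraMap l' L₁) with hT₁def
  have hT₁N : T₁ ≤ N := by
    refine sup_le ?_ ?_
    · have h1 : AL.toSubring.map (algebraMap Lad L₁) ≤ N := by
        rintro _ ⟨x, hx, rfl⟩; exact hALN x hx
      exact (nrIn_mono h1).trans (le_of_eq hNn)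
    · rintro _ ⟨x, hx, rfl⟩; exact hOl'N x hx
  have hC₀T₁ : C₀.map (algebraMap K L₁) ≤ T₁ := by
    rw [Subring.map_le_iff_le_comap, hC₀, Subring.closure_le]
    rintro y (⟨z, hz, rfl⟩ | hy)
    · refine (le_sup_right : _ ≤ T₁) ⟨algebraMap kb l' z, ?_, ?_⟩
      · show algebraMap kb l' z ∈ Ol'
        have : z ∈ Ol'.comap (algebraMap kb l') := by rw [hOl'kb]; exact hz
        exact this
      · show (((algebraMap kb l' z : l') : Lad) : L₁) = algebraMap K L₁ (algebraMap kb K z)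
        rfl
    · refine (le_sup_left : _ ≤ T₁) (le_nrIn _ ⟨algebraMap K Lad y, ?_, rfl⟩)
      exact hA₂AL y (hA₁A₂ (Algebra.subset_adjoin (Or.inl (Or.inr hy))))
  have hkey : etaModel l' (nrIn (AL.toSubring.map (algebraMap Lad L₁))) Ol'.toSubring = N := by
    apply le_antisymm
    · calc etaModel l' (nrIn (AL.toSubring.map (algebraMap Lad L₁))) Ol'.toSubring
          = nrIn T₁ := rfl
        _ ≤ nrIn N := nrIn_mono hT₁N
        _ = N := hNn
    · have h1 : A'.map (algebraMap K L₁) ≤ nrIn T₁ := by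
        rintro _ ⟨x, hx, rfl⟩
        have hx' : IsIntegral C₀ x := by
          rw [hA'C₀] at hx
          exact hx
        exact isIntegral_map_of_map_le (algebraMap K L₁) hC₀T₁ hx'
      have h2 := nrIn_mono h1
      rw [nrIn_nrIn, ← hNeq] at h2
      exact h2
  have hXS₂ : etaModel l' (nrIn (AL.toSubring.map (algebraMap Lad L₁))) Ol'.toSubring ≤
      O₁'.toSubring := by rw [hkey]; exact hN
  ------------------------------------------------------------------
  -- `m` as an `l'`-algebra
  ------------------------------------------------------------------
  letI instl'l : Algebra l' l := e.toAlgebra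
  letI instl'm : Algebra l' m := ((algebraMap l m).comp e).toAlgebra
  letI : Module l' l := Algebra.toModule
  letI : SMul l' l := Algebra.toSMul
  letI : Module l' m := Algebra.toModule
  letI : SMul l' m := Algebra.toSMul
  haveI : IsScalarTower l' l m := IsScalarTower.of_algebraMap_eq fun _ => rfl
  haveI : Module.Finite l' l :=
    Module.Finite.of_surjective (Algebra.linearMap l' l) he_surj
  haveI : FiniteDimensional l' m := Module.Finite.trans l m
  have hOm' : Om.comap (algebraMap l' m) = Ol' := by
    ext x
    have h1 : e x ∈ Om.comap (algebraMap l m) ↔ e x ∈ O₁'.comap (algebraMap l L₁) := by rw [hOm]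
    exact h1
  have hOm₂ : ∀ c : Ol'.toSubring, algebraMap l' m c ∈ Om := fun c => by
    have : (c : l') ∈ Om.comap (algebraMap l' m) := by rw [hOm']; exact c.2
    exact this
  ------------------------------------------------------------------
  -- the smooth-equivalence of Thm. 3.3.1, over `l'°` and for the model `A_L`
  ------------------------------------------------------------------
  have hOl'N' : ∀ c : Ol'.toSubring, ((algebraMap l' L₁).comp Ol'.toSubring.subtype) c ∈ N :=
    fun c => hOl'N c c.2
  have hSE₂ : AreSmoothEquivalent
      (etaModelBaseMap (nrIn (AL.toSubring.map (algebraMap Lad L₁))) Ol'.toSubring)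
      (((algebraMap l' m).comp Ol'.toSubring.subtype).codRestrict Om hOm₂)
      ((maximalIdeal O₁').comap (Subring.inclusion hXS₂)) (maximalIdeal Om) := by
    rw [areSmoothEquivalent_congr_of_eq O₁' hkey hXS₂ hN
      (etaModelBaseMap (nrIn (AL.toSubring.map (algebraMap Lad L₁))) Ol'.toSubring)
      (((algebraMap l' L₁).comp Ol'.toSubring.subtype).codRestrict N hOl'N') (fun _ => rfl)]
    -- base change from `k̄°` to `l'°`
    have hObOl' : ∀ y : Ob, (algKbl'.comp Ob.subtype) y ∈ Ol'.toSubring := fun y => by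
      show algebraMap kb l' (y : kb) ∈ Ol'
      have : (y : kb) ∈ Ol'.comap (algebraMap kb l') := by rw [hOl'kb]; exact y.2
      exact this
    let φ : Ob →+* Ol'.toSubring := (algKbl'.comp Ob.subtype).codRestrict Ol'.toSubring hObOl'
    have hφ : ∀ x : Ol'.toSubring, ∃ n : ℕ, x ^ q ^ n ∈ φ.range := fun x =>
      ⟨nn x, ⟨yy x, hyyOb x x.2⟩, Subtype.ext (by
        rw [SubmonoidClass.coe_pow]
        exact hyy x)⟩
    let iN : k →+* N := ((algebraMap kb L₁).comp (algebraMap k kb)).codRestrict N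
      fun c => hkN ⟨algebraMap k kb c, hkOb c⟩
    refine AreSmoothEquivalent.of_comp_of_forall_pow_mem q iN φ hφ _ _ ?_
    have hf : (((algebraMap l' L₁).comp Ol'.toSubring.subtype).codRestrict N hOl'N').comp φ =
        ((algebraMap kb L₁).comp Ob.subtype).codRestrict N hkN :=
      RingHom.ext fun y => Subtype.ext (halgkbl' y)
    have hg : (((algebraMap l' m).comp Ol'.toSubring.subtype).codRestrict Om hOm₂).comp φ =
        ((algebraMap kb m).comp Ob.subtype).codRestrict Om hkm :=
      RingHom.ext fun y => Subtype.ext (by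
        show algebraMap l m (e (algebraMap kb l' y)) = algebraMap kb m y
        rw [he_alg, ← IsScalarTower.algebraMap_apply kb l m])
    rw [hf, hg]
    exact hSE
  ------------------------------------------------------------------
  -- Steps 3–4 (`Temkin2013_Steps34_tower`) for `(k, L, L°, l', B', A_L, L₁, L₁°, m, m°)`
  ------------------------------------------------------------------
  have hOLcomap : O₁'.comap (algebraMap Lad L₁) = OL := rfl
  have hconclL : Temkin2013DescentConclusion k Lad OL AL L₁ O₁' :=
    h34 k Lad hfgL OL hkOL l' hl'fg hdiml'.le hDY B' hB'O hB'fg hB'fr AL hALO hALfg hALfr hALn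
      hB'AL L₁ inferInstance O₁' hOLcomap m inferInstance Om hOm' hXS₂ hOm₂ hSE₂
  ------------------------------------------------------------------
  -- Step 0: back to `K`, `X″` and `K₁`, then to `X`
  ------------------------------------------------------------------
  have hgen : Algebra.adjoin K₁ (Set.range (algebraMap Lad L₁)) = ⊤ := by
    rw [eq_top_iff, ← hK₁l]
    refine Algebra.adjoin_mono ?_
    intro x hx
    exact ⟨⟨x, hlLad hx⟩, rfl⟩
  have hconclK : Temkin2013DescentConclusion k K O A₂ K₁ O₁ :=
    Temkin2013DescentConclusion.of_purelyInseparable O A₂ hA₂fg hA₂fr Lad OL hOLK AL hA₂AL K₁ O₁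
      L₁ hgen O₁' hO₁' hconclL
  exact Temkin2013DescentConclusion.of_le O hAA₂ hconclK

end defectStep

/-! ### Corollaries: the frontier lists moved to the corrected fact -/

/-- **Thm. 4.1.1 (`n = 1`, non-logarithmic form)** from the Abhyankar case (Step 0 ⇐
Thm. 5.5.2), Thm. 3.3.1 and the corrected Steps 3–4. [cite: Temkin2013, Thm. 4.1.1, proof (pp. 47–50)] -/
theorem Temkin2013Descent.of_relativeCurve_of_steps34_tower (h0 : Temkin2013DescentAbhyankar.{u})
    (h331 : Temkin2013RelativeCurve.{u}) (h34 : Temkin2013_Steps34_tower.{u}) :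
    Temkin2013Descent.{u} :=
  Temkin2013Descent.of_defect h0
    (Temkin2013DescentDefectStep.of_relativeCurve_of_steps34_tower h331 h34)

/-- The height-`≤ 1` case from `{Temkin2013DescentAbhyankar, Temkin2013RelativeCurve,
Temkin2013_Steps34_tower}`. [folklore] -/
theorem Temkin2013HeightLeOne.of_curve_frontier_tower (h0 : Temkin2013DescentAbhyankar.{u})
    (h331 : Temkin2013RelativeCurve.{u}) (h34 : Temkin2013_Steps34_tower.{u}) :
    Temkin2013HeightLeOne.{u} :=
  Temkin2013HeightLeOne.of_defect_frontier h0
    (Temkin2013DescentDefectStep.of_relativeCurve_of_steps34_tower h331 h34)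

/-- **The current frontier of `Temkin2013DescentDefectStep`** (the induction step on the
transcendence defect, Thm. 4.1.1, Steps 1–4): the classical curve-smoothing lemma
(`Temkin2013CurveSmoothing`, Step 1 of the proof of Thm. 3.3.1), Thm. 3.3.1 for smooth generic
fibres (`Temkin2013RelativeCurveSmoothFibre`, Berkovich-analytic) and the corrected Steps 3–4
(`Temkin2013_Steps34_tower`); the layers in between (`Temkin2013RelativeCurve.of_smoothGenericFibre`,
Steps 0–2) are proved. [cite: Temkin2013, Thm. 4.1.1, proof, Steps 1–4 (arXiv:0804.1554v3 pp. 47–50)] -/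
theorem Temkin2013DescentDefectStep.of_curve_frontier_tower (hcs : Temkin2013CurveSmoothing.{u})
    (hsf : Temkin2013RelativeCurveSmoothFibre.{u}) (h34 : Temkin2013_Steps34_tower.{u}) :
    Temkin2013DescentDefectStep.{u} :=
  Temkin2013DescentDefectStep.of_relativeCurve_of_steps34_tower
    (Temkin2013RelativeCurve.of_smoothGenericFibre hcs hsf) h34

/-- **Thm. 4.1.1 (`n = 1`, descent form) from `{Temkin2013Abhyankar, Temkin2013CurveSmoothing,
Temkin2013RelativeCurveSmoothFibre, Temkin2013_Steps34_tower}`.**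
[cite: Temkin2013, Thm. 4.1.1, proof (arXiv:0804.1554v3 pp. 47–50)] -/
theorem Temkin2013Descent.of_frontier₃_tower (hA : Temkin2013Abhyankar.{u})
    (hcs : Temkin2013CurveSmoothing.{u}) (hsf : Temkin2013RelativeCurveSmoothFibre.{u})
    (h34 : Temkin2013_Steps34_tower.{u}) : Temkin2013Descent.{u} :=
  Temkin2013Descent.of_relativeCurve_of_steps34_tower hA.descentAbhyankar
    (Temkin2013RelativeCurve.of_smoothGenericFibre hcs hsf) h34

/-- Thm. 1.3.2 in height `≤ 1` (corrected relative form) from the same four facts. [folklore] -/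
theorem Temkin2013HeightLeOne.of_frontier₃_tower (hA : Temkin2013Abhyankar.{u})
    (hcs : Temkin2013CurveSmoothing.{u}) (hsf : Temkin2013RelativeCurveSmoothFibre.{u})
    (h34 : Temkin2013_Steps34_tower.{u}) : Temkin2013HeightLeOne.{u} :=
  Temkin2013HeightLeOne.of_curve_frontier_tower hA.descentAbhyankar
    (Temkin2013RelativeCurve.of_smoothGenericFibre hcs hsf) h34

end Literature.AlgebraicGeometry.Resolution
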